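import Mathlib
import HarnessLib
import Summits.NavierStokesRegularity.NavierStokesRegularity.Theorems.QuarterLogPincerEmberCensusDefs

/-!
# Route `QuarterLogPincer`, crux `TypeIQuantSubcubicExp` (stmt-NavierStokesRegularity-24077), line `ember_census` —
# the line's PROVED KERNEL, by name: terminal descendants

VERBATIM port (bodies byte-identical up to the unfolding of `E3`) of the sorry-free kernel of §E of
`Cruxes/TypeIQuantSubcubicExp/Lines/ember_census.lean` (v1.1), §E.K1: `exists_terminal_descendant` (every hot event has a
terminal descendant — the clock bounds the generations), over the landed objects `…EmberCensusDefs`.  The edge §E.K2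
`flarePersistence_of_hotWitness_of_terminalEmber` is NOT ported yet: its hypothesis E1 `HotWitness` is being split
(director-ns dss_141 / dss_147) and the edge will be re-typed over `HotWitnessFar ⊕ HotWitnessNear` by the custodian.  The
stubs and their pluggings are NOT ported.  HONEST FRAME: a
combinatorial lemma about hot events of HYPOTHETICAL fields; E1/E2 are OPEN stubs of the line; nothing here bears on
24077's truth, W7 or Navier–Stokes regularity (OPEN / not proved).  pub-ns-dss typer (g38),
`--supports stmt-NavierStokesRegularity-24077`; bodies by ns-idea-7 (g12).
-/

set_option linter.dupNamespace false

namespace Summit.NavierStokesRegularity.NavierStokesRegularity.Cruxes.TypeIQuantSubcubicExp.EmberCensus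

noncomputable section

open MeasureTheory Set Function Filter Topology Metric
open scoped ENNReal NNReal Classical
open Literature.Analysis Literature.Analysis.FluidPDE

/-- **Terminal descendant.**  If `(y,t)` is hot, `t ≤ t₁ < T'`, `K ≥ 0`, there is a TERMINAL hot event
`(y',t')` with `t ≤ t' ≤ t₁` and `‖y' − y‖ ≤ 8K(√(T'−t) − √(T'−t'))` (`≤ 8K√(T'−t)`).  Proof: strong
induction on the number `n` of clock halvings above `√(T'−t₁) > 0` (`T'−t ≤ 4ⁿ(T'−t₁)`); a non-terminal
event links to a hot event of at most half its clock within `4K√(T'−t)`, and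
`4K√(T'−t) + 8K√(T'−t') ≤ 8K√(T'−t)` because `2√(T'−t') ≤ √(T'−t)`. -/
theorem exists_terminal_descendant {K ε T' t₁ : ℝ} {u : ℝ → (EuclideanSpace ℝ (Fin 3)) → (EuclideanSpace ℝ (Fin 3))}
    (hK : 0 ≤ K) (ht₁ : t₁ < T')
    {y : (EuclideanSpace ℝ (Fin 3))} {t : ℝ} (hhot : Hot ε T' u y t) (ht : t ≤ t₁) :
    ∃ (y' : (EuclideanSpace ℝ (Fin 3))) (t' : ℝ), Hot ε T' u y' t' ∧ Terminal K ε T' t₁ u y' t' ∧ t ≤ t' ∧ t' ≤ t₁ ∧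
      ‖y' - y‖ ≤ 8 * K * (Real.sqrt (T' - t) - Real.sqrt (T' - t')) := by
  suffices H : ∀ n : ℕ, ∀ (y : (EuclideanSpace ℝ (Fin 3))) (t : ℝ), Hot ε T' u y t → t ≤ t₁ → T' - t ≤ 4 ^ n * (T' - t₁) →
      ∃ (y' : (EuclideanSpace ℝ (Fin 3))) (t' : ℝ), Hot ε T' u y' t' ∧ Terminal K ε T' t₁ u y' t' ∧ t ≤ t' ∧ t' ≤ t₁ ∧
        ‖y' - y‖ ≤ 8 * K * (Real.sqrt (T' - t) - Real.sqrt (T' - t')) by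
    have hpos : 0 < T' - t₁ := by linarith
    obtain ⟨n, hn⟩ := pow_unbounded_of_one_lt ((T' - t) / (T' - t₁)) (by norm_num : (1 : ℝ) < 4)
    refine H n y t hhot ht ?_
    have := (div_lt_iff₀ hpos).1 hn
    linarith
  have hs4 : Real.sqrt 4 = 2 := by
    rw [show (4 : ℝ) = 2 ^ 2 by norm_num, Real.sqrt_sq (by norm_num : (0 : ℝ) ≤ 2)]
  intro n
  induction n with
  | zero =>
    intro y t hhot ht hgen
    simp only [pow_zero, one_mul] at hgen
    have hteq : t = t₁ := le_antisymm ht (by linarith)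
    refine ⟨y, t, hhot, ?_, le_rfl, ht, by simp⟩
    intro y' t' hlt hle _ _ _
    linarith
  | succ n ih =>
    intro y t hhot ht hgen
    by_cases hterm : Terminal K ε T' t₁ u y t
    · exact ⟨y, t, hhot, hterm, le_rfl, ht, by simp⟩
    · unfold Terminal at hterm
      push Not at hterm
      obtain ⟨y', t', hlt, hle, h4, hdist, hhot'⟩ := hterm
      have hgen' : T' - t' ≤ 4 ^ n * (T' - t₁) := by
        have e : (4 : ℝ) ^ (n + 1) = 4 * 4 ^ n := by ring
        rw [e] at hgen
        linarith
      obtain ⟨y'', t'', hhot'', hterm'', ht't'', ht''le, hdist'⟩ := ih y' t' hhot' hle hgen'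
      refine ⟨y'', t'', hhot'', hterm'', by linarith, ht''le, ?_⟩
      have h2 : 2 * Real.sqrt (T' - t') ≤ Real.sqrt (T' - t) := by
        rw [← hs4, ← Real.sqrt_mul (by norm_num : (0 : ℝ) ≤ 4)]
        exact Real.sqrt_le_sqrt (by linarith)
      have h2K := mul_le_mul_of_nonneg_left h2 hK
      calc ‖y'' - y‖ ≤ ‖y'' - y'‖ + ‖y' - y‖ := norm_sub_le_norm_sub_add_norm_sub _ _ _
        _ ≤ 8 * K * (Real.sqrt (T' - t') - Real.sqrt (T' - t'')) + 4 * K * Real.sqrt (T' - t) :=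
            add_le_add hdist' hdist
        _ ≤ 8 * K * (Real.sqrt (T' - t) - Real.sqrt (T' - t'')) := by linarith

end

end Summit.NavierStokesRegularity.NavierStokesRegularity.Cruxes.TypeIQuantSubcubicExp.EmberCensus
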